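import Summits.QuantumFields.YangMills.Theorems.BalabanUVNodesN22W1RelCentredDatumKnitL2U
import Summits.QuantumFields.YangMills.Theorems.BalabanUVNodesRateReadingOfRecord13CoPH
import Literature.MathematicalPhysics.QuantumFieldTheory.Balaban1983to89.Node00.HistoryTermIndexedGeneratorTotal

/-!
# BalabanUVNodes ∕ node N22 = NE9 — THE RELATIVE-DISC CENTRED ROAD OVER THE ADMISSIBLE CLASS, MODULE J19: THE K3⁷-FACING BINDER STOREYS KEYED ON THE KNIT IN PRIMITIVE ∕ LEMMA-2-SENTENCE
# CURRENCY (CoPH edition; binder `θ : Stage13HParams F N`, proviso core `θ.Provisos₁₃CoPH F N`) — N22's conjunct of `KeyedRates rr` at the level-selected tuple reading of record FROM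
# node N18 below + the letter signs + per tuple ∃(datum family, unscaled data with the unscaled-field law, thickening, ONE `SliceInputsL2U` record per slice, tables, numerals)

Cell `pub-ymgap`, HUMAN RULING D-0062 (Track A), R134 ACCELERATION re-seat `pub-ymgap-dag-n22-c` (strategy s1), generation 10, file J19.  THEOREMS ONLY; imports J17-K `…DatumKnitL2U` (the
knit over Lemma-2-sentence located inputs; through it J17-M, J17-D, J10c, J11), dag-n22-e's v1.7 home `…RateReadingOfRecord13CoPH` (`readingOfRecord₁₃CoPH`, `rateCarriersOfRecord₁₃CoPH`,
`readingOfRecord₁₃CoPH_bundle_u3 … := rfl`) and W1-6 `Node00/HistoryTermIndexedGeneratorTotal` (the literally generated towers `Gn₀`, `TermData214.Gn₀_eq`) BY NAME.  `--supports` K3⁷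
`SpineGivenEndpointR13SepCoPH` (stmt-QuantumFields-20544) as a helper.  Statement shape = this seat's J3ᶜᵖʰ `…TermDatum214WindowDilatedKeyedCoPH` (p574065 ✓) with the MEMBER
hypotheses of the window-dilated engine REPLACED by the knit's located antecedent (the text of J3ᶜᵖʰ's binders and proofs re-used; `gen/build_j19.py`).

WHY.  The K3⁷ skeleton's N22 binder «`∀ F θ hP, θ.Admissible F N → ∀ g₀ os, N22At (rr F θ hP g₀ os).u3`» was so far served by storeys keyed on ENGINES (R2ᶜᵖʰ p574049: the continued
family `TFc` with (S-last-T′) ∕ (S-226-T′) ∕ (S-vertex-T′) displayed; J3ᶜᵖʰ p574065: the window-dilated members `mF` with their six statements displayed).  The J-series knit (J9 → J10c →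
J12-K → J17-K) DISCHARGES those member statements from the (2.14) datum, the unscaled-field law and one located-input record per slice — but no K3⁷-facing storey was keyed on the knit.
THIS FILE is that storey, on the repaired knit J17-K (leading parts configuration-dependent): the tuple's ∃ carries NO member ∕ engine statement — only the datum family `𝔇`, the unscaled
data `χᵘ χᶜᵘ 𝒲 𝒪` with W1-11's law on the window, the thickening family `Wt ⊇ U^c`, `Nonempty (SliceInputsL2U …)` per slice below the selected run length, the tables' inclusion and
restriction law, and the numerals (jointly satisfiable at `consts`: module J14; located antecedent `hlaw ∧ ιL2 ∧ hWsp` inhabited at degenerate data: module J17-W §3).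

WHAT.  §1 ★ `n22_tupleReadingOfRecordCoPHOn_unscaledLawDatumL2U_of_n18Below` (free generator family `Gn` identified with the datum's at the selected run length; guarded by any regime
`Rg`) · `n22_tupleReadingOfRecordCoPH_unscaledLawDatumL2U_of_n18Below` (unguarded = the skeleton's binder verbatim); §2 ★ `n22_tupleReadingOfRecordCoPHOn_unscaledLawDatumL2U₀_of_n18Below` ·
`n22_tupleReadingOfRecordCoPH_unscaledLawDatumL2U₀_of_n18Below` (the LITERALLY GENERATED reading `Gn := fun F θ k ↦ (𝔇 F θ k).Gn₀`, identification by `Gn₀_eq`).  Proof: J17-K §2 once per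
tuple (`readingOfRecord₁₃CoPH_bundle_u3`, `rfl`; the slice records by `Classical.choice` from `Nonempty`).

HONEST FRAMING.  Count-neutral by-name knit; NOT a discharge of N22 (typed 28∕28 · discharged 5∕27 UNCHANGED), NOT a closer of `stub_rates13`; ONE conjunct of `KeyedRates`.  Every located
input in the tuple is a HYPOTHESIS whose inhabitant at the datum of record is another lane's (NODE A: kernel letters ∕ laws — module J16; definers ∕ N10 ∕ N09: Lemma 2's sentence for the
potentials of the unscaled-field law on the thickening, the boxes with (2.22), the older terms' laws — module J15, the profile, the closures; def-W1: the datum and the law; N18: `h18`); no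
inhabitant of `IsDatumOfRecord₁₃CCoPH` ∕ admissible tuple claimed (K0 OPEN); vacuous where `AdmBg … = ∅`; nothing of Bałaban's asserted; NE9 NOT IN PRINT for d = 4; one finite
four-torus programme at fixed ε — NOT infinite volume, NOT OS on ℝ⁴, NOT a mass gap, NOT Clay.  0 `sorry`, 0 `def`, standard axioms.

References (TYPES only): [I] = [Balaban1987RG1] (0.23)–(0.25) pp. 256–257, §1 p. 263, (2.8)–(2.13) pp. 266–268; [II] = [Balaban1988RG2Cluster] Lemma 2 (1.41)–(1.43) p. 11,
(2.9)–(2.15) pp. 14–16, (2.16)–(2.26) pp. 16–17, Lemma 3 p. 20, (2.39)–(2.41) p. 21.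
-/

noncomputable section

open scoped Matrix.Norms.L2Operator

namespace YMDAG.N22.W1

open Set Metric
open scoped BigOperators
open Literature.MathematicalPhysics.QuantumFieldTheory.Balaban1983to89
open Literature.MathematicalPhysics.QuantumFieldTheory.Balaban1983to89.T4Continuum
open Literature.MathematicalPhysics.QuantumFieldTheory.Balaban1983to89.T4OutputRate
open Literature.MathematicalPhysics.QuantumFieldTheory.Balaban1983to89.TreeLengthTorus (TPt TDom tsys torusTreeLen torusTreeLen_nonneg)
open Literature.MathematicalPhysics.QuantumFieldTheory.Balaban1983to89.B12TreeDecay (K₀ K₀_pos)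
open Literature.MathematicalPhysics.QuantumFieldTheory.Balaban1983to89.B13Lemma3TorusData (TBond)
open Literature.MathematicalPhysics.QuantumFieldTheory.Balaban1983to89.B13Lemma3TorusTerms (terms weight weight_nonneg)
open Literature.MathematicalPhysics.QuantumFieldTheory.Balaban1983to89.B13Lemma3TorusSocket (Lemma3Numerics)
open Literature.MathematicalPhysics.QuantumFieldTheory.Balaban1983to89.Step (SFConsts)
open Literature.MathematicalPhysics.QuantumFieldTheory.Balaban1983to89.Node00
  (Stage12Params Stage13Params Stage13HParams U3Objects₁₁ U3Letters₁₁ NE2Objects₁₁ NE3Letters₁₁ MatA ιSU prependCoupling)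
open Literature.MathematicalPhysics.QuantumFieldTheory.Balaban1983to89.Node00.Sect2 (domSys domCount CPair ofBackgroundC spaceI domSites Setting Residual)
open Literature.MathematicalPhysics.QuantumFieldTheory.Balaban1983to89.Node00.W1
open YMDAG.UVSplit

variable {N : ℕ} [NeZero N]

/-! ## §1 Free generator family `Gn` identified with the datum's at the selected run length -/

section TupleReading

variable (Gn : (F : T4Family) → (θ : Stage13HParams F N) → (k : ℕ) → GenTower (F.P k) (MatA N) θ.τ9.M)
  (sp : (F : T4Family) → (θ : Stage13HParams F N) → (k j : ℕ) → (domSys (F.P k) θ.τ9.M j).Dom → Set (CPair (F.P k) (MatA N)))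
  (gauge : (F : T4Family) → (θ : Stage13HParams F N) → (k : ℕ) → GaugeField (F.P k) 0 (Node00.SU N) → GaugeField (F.P k) 0 (Node00.SU N) → ℝ)
  (hg : ∀ (F : T4Family) (θ : Stage13HParams F N) (k : ℕ) (U U' : GaugeField (F.P k) 0 (Node00.SU N)), 0 ≤ gauge F θ k U U')
  (T₀ : (F : T4Family) → (θ : Stage13HParams F N) → (k : ℕ) → GaugeField (F.P (k + 1)) 0 (Node00.SU N) → GaugeField (F.P k) 0 (Node00.SU N))
  (hT : ∀ (F : T4Family) (θ : Stage13HParams F N) (k : ℕ) (U : GaugeField (F.P (k + 1)) 0 (Node00.SU N)),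
    (∀ (j : ℕ) (Y : (domSys (F.P (k + 1)) θ.τ9.M j).Dom), ofBackgroundC (ιSU N) U ∈ sp F θ (k + 1) j Y) →
      ∀ (j : ℕ) (X : (domSys (F.P k) θ.τ9.M j).Dom), ofBackgroundC (ιSU N) (T₀ F θ k U) ∈ sp F θ k j X)
  (li : (F : T4Family) → Stage13HParams F N → LetterInputs) (ℓ₃ : T4Family → NE3Letters₁₁)
  (ne2 : (F : T4Family) → Stage13HParams F N → (ℕ → ℝ) → List (ULoop F) → ℕ → NE2Objects₁₁)
  (ne1 : (F : T4Family) → Stage13HParams F N → (ℕ → ℝ) → List (ULoop F) → NE1pCarriers)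
  (ksel : (F : T4Family) → Stage13HParams F N → (ℕ → ℝ) → List (ULoop F) → ℕ)
  (Rg : (F : T4Family) → Stage13HParams F N → Prop) {G : Type*} [GaugeGroup G]

open Classical in
/-- **★ N22's CONJUNCT OF `KeyedRates rr` AT THE LEVEL-SELECTED TUPLE READING OF RECORD (CoPH EDITION) ON THE GENERATED ADMISSIBLE RUN TOWERS, FROM THE KNIT's LOCATED ANTECEDENT IN
PRIMITIVE ∕ LEMMA-2-SENTENCE CURRENCY, GUARDED BY ANY REGIME `Rg`**: for `rr F θ hP g₀ os := rateCarriersOfRecord₁₃CoPH (readingOfRecord₁₃CoPH (fun F θ ↦ ReadingData.ofRecordAdm F θ.τ9.M N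
(runTowers fun k ↦ toClusterTower (Gn F θ k)) …) ℓ₃ ne2 ne1) F θ hP g₀ os (ksel F θ g₀ os)`: node N18 at the run lengths BELOW the selected one at the same reading + the letter signs
(`li.s = ½`, `li.μ = 1`) + per `(F, θ, g₀, os)` in the regime ∃(`NeZero θ.τ9.M`, `Sg`, `Rz`, `cs`, `c`, `L`, `NeZero L`, letters `a a₂ a₂′ a₅ a₅′ Aabs r₁ E₀ Mv cA cP ρb`, a (2.14)
term-datum family `𝔇` with `Gn F θ (ksel …) = 𝔇.Gn`, UNSCALED DATA `χᵘ χᶜᵘ 𝒲 𝒪` of every step, a THICKENING family `Wt`): module J17-K's hypotheses — the table inclusion `hspk` and the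
restriction law `hrestr` of the tables; the capstone ∕ [KP86] ∕ slack ∕ S25 ∕ renewal numerals; the apertures `0 < cA < cP < 1`, `cP∕(1−cP) < ρb < 1`, `0 < Mv`,
`(1−cP)⁻²Mv((1+cA)γ)² ≤ ½`, `2(1−cP)⁻²Mv·E₀(1+cA)² ≤ li.A`, `li.r ≤ min(cA,1)`; `1 ≤ κ₁`, `α₆ ≠ 0`; THE UNSCALED-FIELD LAW `𝔇.UnscaledFieldLawOn χᵘ χᶜᵘ 𝒲 𝒪 γ` (W1-11); the
thickening over the tables `U^c(X) ⊆ Wt k′ X`; and, below `ksel`, per slice `(k′, X ⊇ Z, t, s₀)`, `Nonempty (SliceInputsL2U (𝔇 k′) … (Wt k′ X) s₀ …)` (J17-D: NODE A's kernel letters and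
laws, [II] Lemma 2's sentence per configuration for the potentials, the boxes at `s₀` with (2.22), the profile, the closures) ⟹ `∀ F θ hP, Rg F θ → θ.Admissible F N → ∀ g₀ os, N22At
(rr F θ hP g₀ os).u3`.  Proof: J17-K §2 once per tuple (`readingOfRecord₁₃CoPH_bundle_u3`, `rfl`; the records by `Classical.choice`).  ONE conjunct — NOT a closer of `stub_rates13`.
[cite: Balaban1988RG2Cluster, Lemma 2 (1.41)-(1.43) p.11, (2.9)-(2.15) pp.14-16, (2.16)-(2.26) pp.16-17, Lemma 3 p.20 and (2.39)-(2.41) p.21; Balaban1987RG1, (0.23)-(0.25) pp.256-257, §1 p.263 and (2.8)-(2.13) pp.266-268] -/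
theorem n22_tupleReadingOfRecordCoPHOn_unscaledLawDatumL2U_of_n18Below
    (h18 : ∀ (F : T4Family) (θ : Stage13HParams F N) (hP : θ.Provisos₁₃CoPH F N), Rg F θ → θ.Admissible F N → ∀ (g₀ : ℕ → ℝ) (os : List (ULoop F)),
      ∀ k' : ℕ, k' < ksel F θ g₀ os → N18At (u3OfRecord₁₃ θ.toStage13Params ((ReadingData.ofRecordAdm F θ.τ9.M N (runTowers fun k => toClusterTower (Gn F θ k)) (sp F θ)
        (gauge F θ) (hg F θ) (T₀ F θ) (hT F θ) (li F θ)).u3Objects θ.γ) k'))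
    (hnum : ∀ (F : T4Family) (θ : Stage13HParams F N), θ.Provisos₁₃CoPH F N → Rg F θ → θ.Admissible F N →
      0 < (li F θ).C₀ ∧ 0 < (li F θ).θ₅ ∧ (li F θ).θ₅ < 1 ∧ 0 ≤ (li F θ).C₅ ∧ 2 * (li F θ).C₅ / (1 - (li F θ).θ₅) ≤ (li F θ).C₀ ∧ 0 < (li F θ).A ∧
        (li F θ).μ = 1 ∧ 0 < (li F θ).r ∧ (li F θ).s = (2 : ℝ)⁻¹)
    (hdata : ∀ (F : T4Family) (θ : Stage13HParams F N), θ.Provisos₁₃CoPH F N → Rg F θ → θ.Admissible F N → ∀ (g₀ : ℕ → ℝ) (os : List (ULoop F)),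
      ∃ (_ : NeZero θ.τ9.M) (Sg : Setting (MatA N) G) (Rz : Residual (F.P (ksel F θ g₀ os)) (MatA N))
        (cs : SFConsts) (c : B13.Consts) (L : ℕ) (_ : NeZero L) (a a₂ a₂' a₅ a₅' Aabs r₁ E₀ Mv cA cP ρb : ℝ)
        (𝔇 : TermData214 c (F.P (ksel F θ g₀ os)) (MatA N) θ.τ9.M L)
        (χu χcu : (k' : ℕ) → (𝔇 k').UnscaledChi) (𝒲 : (k' : ℕ) → (𝔇 k').UnscaledWilson) (𝒪 : (k' : ℕ) → (𝔇 k').UnscaledOlder)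
        (Wt : (k' : ℕ) → (domSys (F.P (ksel F θ g₀ os)) θ.τ9.M (k' + 1)).Dom → Set (CPair (F.P (ksel F θ g₀ os)) (MatA N))),
        Gn F θ (ksel F θ g₀ os) = 𝔇.Gn ∧
        (∀ (j : ℕ) (Y : (domSys (F.P (ksel F θ g₀ os)) θ.τ9.M j).Dom),
          sp F θ (ksel F θ g₀ os) j Y ⊆ spaceI Sg Rz θ.τ9.M j (domSites (F.P (ksel F θ g₀ os)) θ.τ9.M j Y) cs.α₀ cs.α₁) ∧
        (∀ j : ℕ, SpRestr (M := θ.τ9.M) (fun Y : (domSys (F.P (ksel F θ g₀ os)) θ.τ9.M (j + 1)).Dom => spaceI Sg Rz θ.τ9.M (j + 1) (domSites (F.P (ksel F θ g₀ os)) θ.τ9.M (j + 1) Y) cs.α₀ cs.α₁)) ∧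
        8 ≤ c.L ∧ c.L = L ∧ Lemma3Numerics c θ.τ9.M ((c.L : ℝ) / 2) a a₂ a₂' a₅' Aabs ∧ 0 ≤ c.C3act * c.ε₁ ∧ 0 ≤ r₁ ∧ (li F θ).κ ≤ r₁ ∧
        r₁ + 2 * (64 * Real.log 162) + 2 ≤ (1 - 8 * c.δ) * ((c.L : ℝ) / 2) * c.κ ∧
        c.C3act * c.ε₁ * Real.exp (5 * r₁ + 1) * K₀ 64 8 * 9 * 64 < 1 ∧
        Real.exp 1 * 9 * 64 * K₀ 64 8 ^ 2 * (c.C3act * c.ε₁) ≤ E₀ ∧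
        (∀ (k' : ℕ) (Z : (domSys (F.P (ksel F θ g₀ os)) θ.τ9.M (k' + 1)).Dom), 2 * Real.exp (a₅ * ((Z.1).card : ℝ)) ≤ Real.exp (a₅' * ((Z.1).card : ℝ))) ∧
        0 < cA ∧ cA < cP ∧ cP < 1 ∧ cP / (1 - cP) < ρb ∧ 0 < Mv ∧ (1 - cP)⁻¹ ^ 2 * Mv * ((1 + cA) * θ.γ) ^ 2 ≤ 1 / 2 ∧
        2 * ((1 - cP)⁻¹ ^ 2 * Mv) * E₀ * (1 + cA) ^ 2 ≤ (li F θ).A ∧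
        𝔇.UnscaledFieldLawOn χu χcu 𝒲 𝒪 θ.γ ∧ 1 ≤ c.κ₁ ∧ c.α₆ ≠ 0 ∧ ρb < 1 ∧
        (∀ (k' : ℕ) (X : (domSys (F.P (ksel F θ g₀ os)) θ.τ9.M (k' + 1)).Dom), spaceI Sg Rz θ.τ9.M (k' + 1) (domSites (F.P (ksel F θ g₀ os)) θ.τ9.M (k' + 1) X) cs.α₀ cs.α₁ ⊆ Wt k' X) ∧
        (∀ k' : ℕ, k' < ksel F θ g₀ os → ∀ (X Z : (domSys (F.P (ksel F θ g₀ os)) θ.τ9.M (k' + 1)).Dom), Z.1 ⊆ X.1 → ∀ t ∈ terms L θ.τ9.M Z, ∀ s₀ ∈ Ioc (0 : ℝ) θ.γ,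
          Nonempty (SliceInputsL2U (𝔇 k') (χu k') (χcu k') (𝒲 k') (𝒪 k') c Sg Rz cs E₀ (li F θ).κ Z t (Wt k' X) s₀ a a₅ ρb Mv)) ∧
        (li F θ).r ≤ min cA 1) :
    ∀ (F : T4Family) (θ : Stage13HParams F N) (hP : θ.Provisos₁₃CoPH F N), Rg F θ → θ.Admissible F N → ∀ (g₀ : ℕ → ℝ) (os : List (ULoop F)),
      N22At (rateCarriersOfRecord₁₃CoPH (readingOfRecord₁₃CoPH (fun F θ => ReadingData.ofRecordAdm F θ.τ9.M N (runTowers fun k => toClusterTower (Gn F θ k)) (sp F θ)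
        (gauge F θ) (hg F θ) (T₀ F θ) (hT F θ) (li F θ)) ℓ₃ ne2 ne1) F θ hP g₀ os (ksel F θ g₀ os)).u3 := by
  intro F θ hP hRg hθ g₀ os
  obtain ⟨hC₀, hθ5, hθ1, hC5, hC₀', hA, hμ, hr, hs⟩ := hnum F θ hP hRg hθ
  obtain ⟨hMz, Sg, Rz, cs, c, L, hLz, a, a₂, a₂', a₅, a₅', Aabs, r₁, E₀, Mv, cA, cP, ρb, 𝔇, χu, χcu, 𝒲, 𝒪, Wt, hGn, hspk, hrestr, hL, hLc, hN, hA0, hr₁, hκ, hrate, hsmall,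
    hrenew, h2w, hc0, hcAP, hcP1, hρb, hMv, hMvγ, hAM, hlaw, hκ₁, hα₆, hρb1, hWsp, hι, hrc⟩ := hdata F θ hP hRg hθ g₀ os
  rw [readingOfRecord₁₃CoPH_bundle_u3]
  exact n22At_u3OfRecord₁₃_ofRecordAdm_runTowers_toClusterTower_of_n18Below_unscaledLawDatumL2U θ.toStage13Params (Gn F θ) (sp F θ) (gauge F θ) (hg F θ) (T₀ F θ) (hT F θ)
    (li F θ) (ksel F θ g₀ os) c 𝔇 χu χcu 𝒲 𝒪 Sg Rz hGn hspk hrestr hL hLc hN hA0 hr₁ hκ hrate hsmall hrenew h2w hc0 hcAP hcP1 hρb hMv hMvγ hAM hlaw hκ₁ hα₆ hρb1 Wt hWsp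
    (fun k' hk X Z hZ t ht s₀ hs₀ => Classical.choice (hι k' hk X Z hZ t ht s₀ hs₀)) (h18 F θ hP hRg hθ g₀ os) hC5 hθ1 hC₀' hC₀ hθ5 hA hμ hr hrc hθ.toStage9.gamma_pos hs

open Classical in
/-- **… UNGUARDED** (the skeleton's binder «`∀ F θ hP, θ.Admissible F N → ∀ g₀ os, N22At (rr F θ hP g₀ os).u3`» verbatim: the guarded form at `Rg := fun _ _ ↦ True`).
[cite: Balaban1988RG2Cluster, Lemma 2 (1.41)-(1.43) p.11, (2.9)-(2.15) pp.14-16, (2.16)-(2.26) pp.16-17, Lemma 3 p.20 and (2.39)-(2.41) p.21; Balaban1987RG1, (0.23)-(0.25) pp.256-257, §1 p.263 and (2.8)-(2.13) pp.266-268] -/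
theorem n22_tupleReadingOfRecordCoPH_unscaledLawDatumL2U_of_n18Below
    (h18 : ∀ (F : T4Family) (θ : Stage13HParams F N) (hP : θ.Provisos₁₃CoPH F N), θ.Admissible F N → ∀ (g₀ : ℕ → ℝ) (os : List (ULoop F)),
      ∀ k' : ℕ, k' < ksel F θ g₀ os → N18At (u3OfRecord₁₃ θ.toStage13Params ((ReadingData.ofRecordAdm F θ.τ9.M N (runTowers fun k => toClusterTower (Gn F θ k)) (sp F θ)
        (gauge F θ) (hg F θ) (T₀ F θ) (hT F θ) (li F θ)).u3Objects θ.γ) k'))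
    (hnum : ∀ (F : T4Family) (θ : Stage13HParams F N), θ.Provisos₁₃CoPH F N → θ.Admissible F N →
      0 < (li F θ).C₀ ∧ 0 < (li F θ).θ₅ ∧ (li F θ).θ₅ < 1 ∧ 0 ≤ (li F θ).C₅ ∧ 2 * (li F θ).C₅ / (1 - (li F θ).θ₅) ≤ (li F θ).C₀ ∧ 0 < (li F θ).A ∧
        (li F θ).μ = 1 ∧ 0 < (li F θ).r ∧ (li F θ).s = (2 : ℝ)⁻¹)
    (hdata : ∀ (F : T4Family) (θ : Stage13HParams F N), θ.Provisos₁₃CoPH F N → θ.Admissible F N → ∀ (g₀ : ℕ → ℝ) (os : List (ULoop F)),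
      ∃ (_ : NeZero θ.τ9.M) (Sg : Setting (MatA N) G) (Rz : Residual (F.P (ksel F θ g₀ os)) (MatA N))
        (cs : SFConsts) (c : B13.Consts) (L : ℕ) (_ : NeZero L) (a a₂ a₂' a₅ a₅' Aabs r₁ E₀ Mv cA cP ρb : ℝ)
        (𝔇 : TermData214 c (F.P (ksel F θ g₀ os)) (MatA N) θ.τ9.M L)
        (χu χcu : (k' : ℕ) → (𝔇 k').UnscaledChi) (𝒲 : (k' : ℕ) → (𝔇 k').UnscaledWilson) (𝒪 : (k' : ℕ) → (𝔇 k').UnscaledOlder)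
        (Wt : (k' : ℕ) → (domSys (F.P (ksel F θ g₀ os)) θ.τ9.M (k' + 1)).Dom → Set (CPair (F.P (ksel F θ g₀ os)) (MatA N))),
        Gn F θ (ksel F θ g₀ os) = 𝔇.Gn ∧
        (∀ (j : ℕ) (Y : (domSys (F.P (ksel F θ g₀ os)) θ.τ9.M j).Dom),
          sp F θ (ksel F θ g₀ os) j Y ⊆ spaceI Sg Rz θ.τ9.M j (domSites (F.P (ksel F θ g₀ os)) θ.τ9.M j Y) cs.α₀ cs.α₁) ∧
        (∀ j : ℕ, SpRestr (M := θ.τ9.M) (fun Y : (domSys (F.P (ksel F θ g₀ os)) θ.τ9.M (j + 1)).Dom => spaceI Sg Rz θ.τ9.M (j + 1) (domSites (F.P (ksel F θ g₀ os)) θ.τ9.M (j + 1) Y) cs.α₀ cs.α₁)) ∧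
        8 ≤ c.L ∧ c.L = L ∧ Lemma3Numerics c θ.τ9.M ((c.L : ℝ) / 2) a a₂ a₂' a₅' Aabs ∧ 0 ≤ c.C3act * c.ε₁ ∧ 0 ≤ r₁ ∧ (li F θ).κ ≤ r₁ ∧
        r₁ + 2 * (64 * Real.log 162) + 2 ≤ (1 - 8 * c.δ) * ((c.L : ℝ) / 2) * c.κ ∧
        c.C3act * c.ε₁ * Real.exp (5 * r₁ + 1) * K₀ 64 8 * 9 * 64 < 1 ∧
        Real.exp 1 * 9 * 64 * K₀ 64 8 ^ 2 * (c.C3act * c.ε₁) ≤ E₀ ∧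
        (∀ (k' : ℕ) (Z : (domSys (F.P (ksel F θ g₀ os)) θ.τ9.M (k' + 1)).Dom), 2 * Real.exp (a₅ * ((Z.1).card : ℝ)) ≤ Real.exp (a₅' * ((Z.1).card : ℝ))) ∧
        0 < cA ∧ cA < cP ∧ cP < 1 ∧ cP / (1 - cP) < ρb ∧ 0 < Mv ∧ (1 - cP)⁻¹ ^ 2 * Mv * ((1 + cA) * θ.γ) ^ 2 ≤ 1 / 2 ∧
        2 * ((1 - cP)⁻¹ ^ 2 * Mv) * E₀ * (1 + cA) ^ 2 ≤ (li F θ).A ∧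
        𝔇.UnscaledFieldLawOn χu χcu 𝒲 𝒪 θ.γ ∧ 1 ≤ c.κ₁ ∧ c.α₆ ≠ 0 ∧ ρb < 1 ∧
        (∀ (k' : ℕ) (X : (domSys (F.P (ksel F θ g₀ os)) θ.τ9.M (k' + 1)).Dom), spaceI Sg Rz θ.τ9.M (k' + 1) (domSites (F.P (ksel F θ g₀ os)) θ.τ9.M (k' + 1) X) cs.α₀ cs.α₁ ⊆ Wt k' X) ∧
        (∀ k' : ℕ, k' < ksel F θ g₀ os → ∀ (X Z : (domSys (F.P (ksel F θ g₀ os)) θ.τ9.M (k' + 1)).Dom), Z.1 ⊆ X.1 → ∀ t ∈ terms L θ.τ9.M Z, ∀ s₀ ∈ Ioc (0 : ℝ) θ.γ,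
          Nonempty (SliceInputsL2U (𝔇 k') (χu k') (χcu k') (𝒲 k') (𝒪 k') c Sg Rz cs E₀ (li F θ).κ Z t (Wt k' X) s₀ a a₅ ρb Mv)) ∧
        (li F θ).r ≤ min cA 1) :
    ∀ (F : T4Family) (θ : Stage13HParams F N) (hP : θ.Provisos₁₃CoPH F N), θ.Admissible F N → ∀ (g₀ : ℕ → ℝ) (os : List (ULoop F)),
      N22At (rateCarriersOfRecord₁₃CoPH (readingOfRecord₁₃CoPH (fun F θ => ReadingData.ofRecordAdm F θ.τ9.M N (runTowers fun k => toClusterTower (Gn F θ k)) (sp F θ)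
        (gauge F θ) (hg F θ) (T₀ F θ) (hT F θ) (li F θ)) ℓ₃ ne2 ne1) F θ hP g₀ os (ksel F θ g₀ os)).u3 :=
  fun F θ hP hθ g₀ os =>
    n22_tupleReadingOfRecordCoPHOn_unscaledLawDatumL2U_of_n18Below Gn sp gauge hg T₀ hT li ℓ₃ ne2 ne1 ksel (fun _ _ => True) (G := G)
      (fun F θ hP _ hθ => h18 F θ hP hθ) (fun F θ hP _ hθ => hnum F θ hP hθ) (fun F θ hP _ hθ => hdata F θ hP hθ) F θ hP trivial hθ g₀ os

end TupleReading

/-! ## §2 The LITERALLY GENERATED reading `Gn := fun F θ k ↦ (𝔇 F θ k).Gn₀` -/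

section Generated

variable (c : (F : T4Family) → Stage13HParams F N → ℕ → B13.Consts) (L : (F : T4Family) → Stage13HParams F N → ℕ → ℕ) [hL : ∀ F θ k, NeZero (L F θ k)]
  (𝔇 : (F : T4Family) → (θ : Stage13HParams F N) → (k : ℕ) → TermData214 (c F θ k) (F.P k) (MatA N) θ.τ9.M (L F θ k))
  (sp : (F : T4Family) → (θ : Stage13HParams F N) → (k j : ℕ) → (domSys (F.P k) θ.τ9.M j).Dom → Set (CPair (F.P k) (MatA N)))
  (gauge : (F : T4Family) → (θ : Stage13HParams F N) → (k : ℕ) → GaugeField (F.P k) 0 (Node00.SU N) → GaugeField (F.P k) 0 (Node00.SU N) → ℝ)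
  (hg : ∀ (F : T4Family) (θ : Stage13HParams F N) (k : ℕ) (U U' : GaugeField (F.P k) 0 (Node00.SU N)), 0 ≤ gauge F θ k U U')
  (T₀ : (F : T4Family) → (θ : Stage13HParams F N) → (k : ℕ) → GaugeField (F.P (k + 1)) 0 (Node00.SU N) → GaugeField (F.P k) 0 (Node00.SU N))
  (hT : ∀ (F : T4Family) (θ : Stage13HParams F N) (k : ℕ) (U : GaugeField (F.P (k + 1)) 0 (Node00.SU N)),
    (∀ (j : ℕ) (Y : (domSys (F.P (k + 1)) θ.τ9.M j).Dom), ofBackgroundC (ιSU N) U ∈ sp F θ (k + 1) j Y) →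
      ∀ (j : ℕ) (X : (domSys (F.P k) θ.τ9.M j).Dom), ofBackgroundC (ιSU N) (T₀ F θ k U) ∈ sp F θ k j X)
  (li : (F : T4Family) → Stage13HParams F N → LetterInputs) (ℓ₃ : T4Family → NE3Letters₁₁)
  (ne2 : (F : T4Family) → Stage13HParams F N → (ℕ → ℝ) → List (ULoop F) → ℕ → NE2Objects₁₁)
  (ne1 : (F : T4Family) → Stage13HParams F N → (ℕ → ℝ) → List (ULoop F) → NE1pCarriers)
  (ksel : (F : T4Family) → Stage13HParams F N → (ℕ → ℝ) → List (ULoop F) → ℕ)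
  (Rg : (F : T4Family) → Stage13HParams F N → Prop) {G : Type*} [GaugeGroup G]

open Classical in
/-- **★ N22's CONJUNCT OF `KeyedRates rr` AT THE LITERALLY GENERATED TUPLE READING OF RECORD (CoPH EDITION), FROM THE KNIT's LOCATED ANTECEDENT IN PRIMITIVE ∕ LEMMA-2-SENTENCE
CURRENCY, GUARDED BY ANY REGIME `Rg`** — §1 at `Gn := fun F θ k ↦ (𝔇 F θ k).Gn₀` for a family of (2.14) term data `𝔇 F θ k : TermData214 (c F θ k) (F.P k) 𝔸 θ.τ9.M (L F θ k)` (W1-9's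
TOTAL generator; the identification `Gn₀ = Gn` by `TermData214.Gn₀_eq` under the tuple's `NeZero θ.τ9.M`); the tuple no longer carries `c`, `L`, `𝔇`.
[cite: Balaban1988RG2Cluster, Lemma 2 (1.41)-(1.43) p.11, (2.9)-(2.15) pp.14-16, (2.16)-(2.26) pp.16-17, Lemma 3 p.20 and (2.39)-(2.41) p.21; Balaban1987RG1, (0.23)-(0.25) pp.256-257, §1 p.263 and (2.8)-(2.13) pp.266-268] -/
theorem n22_tupleReadingOfRecordCoPHOn_unscaledLawDatumL2U₀_of_n18Below
    (h18 : ∀ (F : T4Family) (θ : Stage13HParams F N) (hP : θ.Provisos₁₃CoPH F N), Rg F θ → θ.Admissible F N → ∀ (g₀ : ℕ → ℝ) (os : List (ULoop F)),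
      ∀ k' : ℕ, k' < ksel F θ g₀ os → N18At (u3OfRecord₁₃ θ.toStage13Params ((ReadingData.ofRecordAdm F θ.τ9.M N (runTowers fun k => toClusterTower ((𝔇 F θ k).Gn₀)) (sp F θ)
        (gauge F θ) (hg F θ) (T₀ F θ) (hT F θ) (li F θ)).u3Objects θ.γ) k'))
    (hnum : ∀ (F : T4Family) (θ : Stage13HParams F N), θ.Provisos₁₃CoPH F N → Rg F θ → θ.Admissible F N →
      0 < (li F θ).C₀ ∧ 0 < (li F θ).θ₅ ∧ (li F θ).θ₅ < 1 ∧ 0 ≤ (li F θ).C₅ ∧ 2 * (li F θ).C₅ / (1 - (li F θ).θ₅) ≤ (li F θ).C₀ ∧ 0 < (li F θ).A ∧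
        (li F θ).μ = 1 ∧ 0 < (li F θ).r ∧ (li F θ).s = (2 : ℝ)⁻¹)
    (hdata : ∀ (F : T4Family) (θ : Stage13HParams F N), θ.Provisos₁₃CoPH F N → Rg F θ → θ.Admissible F N → ∀ (g₀ : ℕ → ℝ) (os : List (ULoop F)),
      ∃ (_ : NeZero θ.τ9.M) (Sg : Setting (MatA N) G) (Rz : Residual (F.P (ksel F θ g₀ os)) (MatA N))
        (cs : SFConsts) (a a₂ a₂' a₅ a₅' Aabs r₁ E₀ Mv cA cP ρb : ℝ)
        (χu χcu : (k' : ℕ) → (𝔇 F θ (ksel F θ g₀ os) k').UnscaledChi) (𝒲 : (k' : ℕ) → (𝔇 F θ (ksel F θ g₀ os) k').UnscaledWilson)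
        (𝒪 : (k' : ℕ) → (𝔇 F θ (ksel F θ g₀ os) k').UnscaledOlder)
        (Wt : (k' : ℕ) → (domSys (F.P (ksel F θ g₀ os)) θ.τ9.M (k' + 1)).Dom → Set (CPair (F.P (ksel F θ g₀ os)) (MatA N))),
        (∀ (j : ℕ) (Y : (domSys (F.P (ksel F θ g₀ os)) θ.τ9.M j).Dom),
          sp F θ (ksel F θ g₀ os) j Y ⊆ spaceI Sg Rz θ.τ9.M j (domSites (F.P (ksel F θ g₀ os)) θ.τ9.M j Y) cs.α₀ cs.α₁) ∧
        (∀ j : ℕ, SpRestr (M := θ.τ9.M) (fun Y : (domSys (F.P (ksel F θ g₀ os)) θ.τ9.M (j + 1)).Dom => spaceI Sg Rz θ.τ9.M (j + 1) (domSites (F.P (ksel F θ g₀ os)) θ.τ9.M (j + 1) Y) cs.α₀ cs.α₁)) ∧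
        8 ≤ (c F θ (ksel F θ g₀ os)).L ∧ (c F θ (ksel F θ g₀ os)).L = (L F θ (ksel F θ g₀ os)) ∧ Lemma3Numerics (c F θ (ksel F θ g₀ os)) θ.τ9.M (((c F θ (ksel F θ g₀ os)).L : ℝ) / 2) a a₂ a₂' a₅' Aabs ∧ 0 ≤ (c F θ (ksel F θ g₀ os)).C3act * (c F θ (ksel F θ g₀ os)).ε₁ ∧ 0 ≤ r₁ ∧ (li F θ).κ ≤ r₁ ∧
        r₁ + 2 * (64 * Real.log 162) + 2 ≤ (1 - 8 * (c F θ (ksel F θ g₀ os)).δ) * (((c F θ (ksel F θ g₀ os)).L : ℝ) / 2) * (c F θ (ksel F θ g₀ os)).κ ∧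
        (c F θ (ksel F θ g₀ os)).C3act * (c F θ (ksel F θ g₀ os)).ε₁ * Real.exp (5 * r₁ + 1) * K₀ 64 8 * 9 * 64 < 1 ∧
        Real.exp 1 * 9 * 64 * K₀ 64 8 ^ 2 * ((c F θ (ksel F θ g₀ os)).C3act * (c F θ (ksel F θ g₀ os)).ε₁) ≤ E₀ ∧
        (∀ (k' : ℕ) (Z : (domSys (F.P (ksel F θ g₀ os)) θ.τ9.M (k' + 1)).Dom), 2 * Real.exp (a₅ * ((Z.1).card : ℝ)) ≤ Real.exp (a₅' * ((Z.1).card : ℝ))) ∧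
        0 < cA ∧ cA < cP ∧ cP < 1 ∧ cP / (1 - cP) < ρb ∧ 0 < Mv ∧ (1 - cP)⁻¹ ^ 2 * Mv * ((1 + cA) * θ.γ) ^ 2 ≤ 1 / 2 ∧
        2 * ((1 - cP)⁻¹ ^ 2 * Mv) * E₀ * (1 + cA) ^ 2 ≤ (li F θ).A ∧
        (𝔇 F θ (ksel F θ g₀ os)).UnscaledFieldLawOn χu χcu 𝒲 𝒪 θ.γ ∧ 1 ≤ (c F θ (ksel F θ g₀ os)).κ₁ ∧ (c F θ (ksel F θ g₀ os)).α₆ ≠ 0 ∧ ρb < 1 ∧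
        (∀ (k' : ℕ) (X : (domSys (F.P (ksel F θ g₀ os)) θ.τ9.M (k' + 1)).Dom), spaceI Sg Rz θ.τ9.M (k' + 1) (domSites (F.P (ksel F θ g₀ os)) θ.τ9.M (k' + 1) X) cs.α₀ cs.α₁ ⊆ Wt k' X) ∧
        (∀ k' : ℕ, k' < ksel F θ g₀ os → ∀ (X Z : (domSys (F.P (ksel F θ g₀ os)) θ.τ9.M (k' + 1)).Dom), Z.1 ⊆ X.1 → ∀ t ∈ terms (L F θ (ksel F θ g₀ os)) θ.τ9.M Z, ∀ s₀ ∈ Ioc (0 : ℝ) θ.γ,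
          Nonempty (SliceInputsL2U ((𝔇 F θ (ksel F θ g₀ os)) k') (χu k') (χcu k') (𝒲 k') (𝒪 k') (c F θ (ksel F θ g₀ os)) Sg Rz cs E₀ (li F θ).κ Z t (Wt k' X) s₀ a a₅ ρb Mv)) ∧
        (li F θ).r ≤ min cA 1) :
    ∀ (F : T4Family) (θ : Stage13HParams F N) (hP : θ.Provisos₁₃CoPH F N), Rg F θ → θ.Admissible F N → ∀ (g₀ : ℕ → ℝ) (os : List (ULoop F)),
      N22At (rateCarriersOfRecord₁₃CoPH (readingOfRecord₁₃CoPH (fun F θ => ReadingData.ofRecordAdm F θ.τ9.M N (runTowers fun k => toClusterTower ((𝔇 F θ k).Gn₀)) (sp F θ)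
        (gauge F θ) (hg F θ) (T₀ F θ) (hT F θ) (li F θ)) ℓ₃ ne2 ne1) F θ hP g₀ os (ksel F θ g₀ os)).u3 := by
  refine n22_tupleReadingOfRecordCoPHOn_unscaledLawDatumL2U_of_n18Below (fun F θ k => (𝔇 F θ k).Gn₀) sp gauge hg T₀ hT li ℓ₃ ne2 ne1 ksel Rg (G := G) h18 hnum
    fun F θ hP hRg hθ g₀ os => ?_
  obtain ⟨hMz, Sg, Rz, cs, a, a₂, a₂', a₅, a₅', Aabs, r₁, E₀, Mv, cA, cP, ρb, χu, χcu, 𝒲, 𝒪, Wt, hspk, hrest⟩ := hdata F θ hP hRg hθ g₀ os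
  exact ⟨hMz, Sg, Rz, cs, c F θ (ksel F θ g₀ os), L F θ (ksel F θ g₀ os), hL F θ (ksel F θ g₀ os), a, a₂, a₂', a₅, a₅', Aabs, r₁, E₀, Mv, cA, cP, ρb, 𝔇 F θ (ksel F θ g₀ os),
    χu, χcu, 𝒲, 𝒪, Wt, TermData214.Gn₀_eq (𝔇 F θ (ksel F θ g₀ os)), hspk, hrest⟩

open Classical in
/-- **… UNGUARDED** (the skeleton's binder verbatim; the guarded form at `Rg := fun _ _ ↦ True`).
[cite: Balaban1988RG2Cluster, Lemma 2 (1.41)-(1.43) p.11, (2.9)-(2.15) pp.14-16, (2.16)-(2.26) pp.16-17, Lemma 3 p.20 and (2.39)-(2.41) p.21; Balaban1987RG1, (0.23)-(0.25) pp.256-257, §1 p.263 and (2.8)-(2.13) pp.266-268] -/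
theorem n22_tupleReadingOfRecordCoPH_unscaledLawDatumL2U₀_of_n18Below
    (h18 : ∀ (F : T4Family) (θ : Stage13HParams F N) (hP : θ.Provisos₁₃CoPH F N), θ.Admissible F N → ∀ (g₀ : ℕ → ℝ) (os : List (ULoop F)),
      ∀ k' : ℕ, k' < ksel F θ g₀ os → N18At (u3OfRecord₁₃ θ.toStage13Params ((ReadingData.ofRecordAdm F θ.τ9.M N (runTowers fun k => toClusterTower ((𝔇 F θ k).Gn₀)) (sp F θ)
        (gauge F θ) (hg F θ) (T₀ F θ) (hT F θ) (li F θ)).u3Objects θ.γ) k'))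
    (hnum : ∀ (F : T4Family) (θ : Stage13HParams F N), θ.Provisos₁₃CoPH F N → θ.Admissible F N →
      0 < (li F θ).C₀ ∧ 0 < (li F θ).θ₅ ∧ (li F θ).θ₅ < 1 ∧ 0 ≤ (li F θ).C₅ ∧ 2 * (li F θ).C₅ / (1 - (li F θ).θ₅) ≤ (li F θ).C₀ ∧ 0 < (li F θ).A ∧
        (li F θ).μ = 1 ∧ 0 < (li F θ).r ∧ (li F θ).s = (2 : ℝ)⁻¹)
    (hdata : ∀ (F : T4Family) (θ : Stage13HParams F N), θ.Provisos₁₃CoPH F N → θ.Admissible F N → ∀ (g₀ : ℕ → ℝ) (os : List (ULoop F)),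
      ∃ (_ : NeZero θ.τ9.M) (Sg : Setting (MatA N) G) (Rz : Residual (F.P (ksel F θ g₀ os)) (MatA N))
        (cs : SFConsts) (a a₂ a₂' a₅ a₅' Aabs r₁ E₀ Mv cA cP ρb : ℝ)
        (χu χcu : (k' : ℕ) → (𝔇 F θ (ksel F θ g₀ os) k').UnscaledChi) (𝒲 : (k' : ℕ) → (𝔇 F θ (ksel F θ g₀ os) k').UnscaledWilson)
        (𝒪 : (k' : ℕ) → (𝔇 F θ (ksel F θ g₀ os) k').UnscaledOlder)
        (Wt : (k' : ℕ) → (domSys (F.P (ksel F θ g₀ os)) θ.τ9.M (k' + 1)).Dom → Set (CPair (F.P (ksel F θ g₀ os)) (MatA N))),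
        (∀ (j : ℕ) (Y : (domSys (F.P (ksel F θ g₀ os)) θ.τ9.M j).Dom),
          sp F θ (ksel F θ g₀ os) j Y ⊆ spaceI Sg Rz θ.τ9.M j (domSites (F.P (ksel F θ g₀ os)) θ.τ9.M j Y) cs.α₀ cs.α₁) ∧
        (∀ j : ℕ, SpRestr (M := θ.τ9.M) (fun Y : (domSys (F.P (ksel F θ g₀ os)) θ.τ9.M (j + 1)).Dom => spaceI Sg Rz θ.τ9.M (j + 1) (domSites (F.P (ksel F θ g₀ os)) θ.τ9.M (j + 1) Y) cs.α₀ cs.α₁)) ∧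
        8 ≤ (c F θ (ksel F θ g₀ os)).L ∧ (c F θ (ksel F θ g₀ os)).L = (L F θ (ksel F θ g₀ os)) ∧ Lemma3Numerics (c F θ (ksel F θ g₀ os)) θ.τ9.M (((c F θ (ksel F θ g₀ os)).L : ℝ) / 2) a a₂ a₂' a₅' Aabs ∧ 0 ≤ (c F θ (ksel F θ g₀ os)).C3act * (c F θ (ksel F θ g₀ os)).ε₁ ∧ 0 ≤ r₁ ∧ (li F θ).κ ≤ r₁ ∧
        r₁ + 2 * (64 * Real.log 162) + 2 ≤ (1 - 8 * (c F θ (ksel F θ g₀ os)).δ) * (((c F θ (ksel F θ g₀ os)).L : ℝ) / 2) * (c F θ (ksel F θ g₀ os)).κ ∧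
        (c F θ (ksel F θ g₀ os)).C3act * (c F θ (ksel F θ g₀ os)).ε₁ * Real.exp (5 * r₁ + 1) * K₀ 64 8 * 9 * 64 < 1 ∧
        Real.exp 1 * 9 * 64 * K₀ 64 8 ^ 2 * ((c F θ (ksel F θ g₀ os)).C3act * (c F θ (ksel F θ g₀ os)).ε₁) ≤ E₀ ∧
        (∀ (k' : ℕ) (Z : (domSys (F.P (ksel F θ g₀ os)) θ.τ9.M (k' + 1)).Dom), 2 * Real.exp (a₅ * ((Z.1).card : ℝ)) ≤ Real.exp (a₅' * ((Z.1).card : ℝ))) ∧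
        0 < cA ∧ cA < cP ∧ cP < 1 ∧ cP / (1 - cP) < ρb ∧ 0 < Mv ∧ (1 - cP)⁻¹ ^ 2 * Mv * ((1 + cA) * θ.γ) ^ 2 ≤ 1 / 2 ∧
        2 * ((1 - cP)⁻¹ ^ 2 * Mv) * E₀ * (1 + cA) ^ 2 ≤ (li F θ).A ∧
        (𝔇 F θ (ksel F θ g₀ os)).UnscaledFieldLawOn χu χcu 𝒲 𝒪 θ.γ ∧ 1 ≤ (c F θ (ksel F θ g₀ os)).κ₁ ∧ (c F θ (ksel F θ g₀ os)).α₆ ≠ 0 ∧ ρb < 1 ∧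
        (∀ (k' : ℕ) (X : (domSys (F.P (ksel F θ g₀ os)) θ.τ9.M (k' + 1)).Dom), spaceI Sg Rz θ.τ9.M (k' + 1) (domSites (F.P (ksel F θ g₀ os)) θ.τ9.M (k' + 1) X) cs.α₀ cs.α₁ ⊆ Wt k' X) ∧
        (∀ k' : ℕ, k' < ksel F θ g₀ os → ∀ (X Z : (domSys (F.P (ksel F θ g₀ os)) θ.τ9.M (k' + 1)).Dom), Z.1 ⊆ X.1 → ∀ t ∈ terms (L F θ (ksel F θ g₀ os)) θ.τ9.M Z, ∀ s₀ ∈ Ioc (0 : ℝ) θ.γ,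
          Nonempty (SliceInputsL2U ((𝔇 F θ (ksel F θ g₀ os)) k') (χu k') (χcu k') (𝒲 k') (𝒪 k') (c F θ (ksel F θ g₀ os)) Sg Rz cs E₀ (li F θ).κ Z t (Wt k' X) s₀ a a₅ ρb Mv)) ∧
        (li F θ).r ≤ min cA 1) :
    ∀ (F : T4Family) (θ : Stage13HParams F N) (hP : θ.Provisos₁₃CoPH F N), θ.Admissible F N → ∀ (g₀ : ℕ → ℝ) (os : List (ULoop F)),
      N22At (rateCarriersOfRecord₁₃CoPH (readingOfRecord₁₃CoPH (fun F θ => ReadingData.ofRecordAdm F θ.τ9.M N (runTowers fun k => toClusterTower ((𝔇 F θ k).Gn₀)) (sp F θ)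
        (gauge F θ) (hg F θ) (T₀ F θ) (hT F θ) (li F θ)) ℓ₃ ne2 ne1) F θ hP g₀ os (ksel F θ g₀ os)).u3 :=
  fun F θ hP hθ g₀ os =>
    n22_tupleReadingOfRecordCoPHOn_unscaledLawDatumL2U₀_of_n18Below c L 𝔇 sp gauge hg T₀ hT li ℓ₃ ne2 ne1 ksel (fun _ _ => True) (G := G)
      (fun F θ hP _ hθ => h18 F θ hP hθ) (fun F θ hP _ hθ => hnum F θ hP hθ) (fun F θ hP _ hθ => hdata F θ hP hθ) F θ hP trivial hθ g₀ os

end Generated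

end YMDAG.N22.W1

end
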